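import Summits.MatrixMultiplication.MatrixMultiplication.Theorems.FarEdgeDescentTwistedStarCore

/-!
# The twisted star `𝔖_n(L)`, part 2: Kronecker factorisation and the reduction of transpose cashing to `L = 1`

Route `FarEdgeDescent` (decomposition cell `decomp-mm`, lens 2 «structural dichotomy», gen 16),
support for the aside `SubLogRate` (stmt-MatrixMultiplication-25371).  Continuation of
`FarEdgeDescentTwistedStarCore` (the definition `twistedStar K n L`, the leaves, the sandwich
`⟨n,n,L⟩ ≤ 𝔖_n(L) ≤ ⟨n,n,L⟩ ⊕ ⟨n,n,L⟩`, `⟨n,n,2L⟩ ≤ 𝔖_n(L) ⊕ 𝔖_n(L)` and its spectral form).  This part proves: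

* the Kronecker factorisation `𝔖_n(L) ≡ 𝔖_n(1) ⊗ ⟨1,1,L⟩` as mutual restrictions
  (`tensorRestrictsTo_kronecker_twistedStar_one`, `tensorRestrictsTo_twistedStar_kronecker_one`),
  so that `F(𝔖_n(L)) = F(𝔖_n(1)) · F⟨1,1,L⟩` (`spectralPoint_twistedStar_eq_mul`);
* the typed question «transpose cashing» `AC_n(L)`: `F⟨n,n,2L⟩ ≤ F(𝔖_n(L))` for every
  universal spectral point `F` (by Strassen's spectral theorem this is asymptotic degeneration
  `𝔖_n(L) ≳ ⟨n,n,2L⟩`; an OPEN statement, defined nowhere and asserted nowhere in this file —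
  it is the intended signature of a route aside) — with the proved pointwise reduction to `L = 1`
  (`spectralPoint_transposeCashing_iff_one`, `transposeCashing_iff_one`) and the proved
  factor-`2` version (`transposeCashing_upToTwo`).

Informal placement (NODE-v16.md of the cell): both tensors are free and tight with identical
quantum functionals, so transpose cashing is implied by Strassen's support-functional conjecture
and refutable only by a new spectral separation — it is «spectrally invisible».

Landing note (decomp-mm-lander-1 g2, mechanical edits only): part 2 of the split of the lens-2 gen-16 kernel
`FarEdgeDescentTwistedStar.lean` (446 lines, sha256 `3e9cbf4a3107cfda…`) at the 400-line limit; statements and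
tactic lines byte-identical; docstrings added on `one_le_spectralPoint_matMul_one_one` and `toKronIdx₂_apply`
(docstring lint); the section variable `{K : Type u} [CommSemiring K]` re-declared as it stood at the split point;
the deleted global folklore lemma `matMulTensor_apply'` (a `dedup.landed` restatement of the `[Field K]`-only
`Literature.…HopcroftKerrRow.matMulTensor_slice_apply`) re-introduced as a local `have … := fun _ _ _ _ _ _ => rfl`
in the five proofs whose `simp` sets name it.

## References

* M. Christandl, P. Vrana, J. Zuiddam, *Universal points in the asymptotic spectrum of tensors*,
  J. AMS 36 (2023) = arXiv:1709.07851, §1.1–§1.2. [ChristandlVranaZuiddam2023]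
* V. Strassen, *The asymptotic spectrum of tensors*, J. reine angew. Math. 384 (1988), 102–152.
  [Strassen1988]
* M. Bläser, *Fast Matrix Multiplication*, Theory of Computing Library, Graduate Surveys 5 (2013),
  §5, Def. 7.2. [Blaser2013]
-/

noncomputable section

open scoped BigOperators

set_option linter.dupNamespace false

namespace Summit.MatrixMultiplication.MatrixMultiplication.Theorems.FarEdgeDescentTwistedStar

open Literature.Computability.AlgebraicComplexity

universe u

section TwistedStar

variable {K : Type u} [CommSemiring K]

/-! ### Kronecker factorisation `𝔖_n(L) ≡ 𝔖_n(1) ⊗ ⟨1,1,L⟩` -/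

/-- Index map `𝔖_n(L)`-slot-1/3 → (`𝔖_n(1) ⊗ ⟨1,1,L⟩`)-slot-1/3. [folklore] -/
def toKronIdx (n L : ℕ) :
    (Fin n × Fin L) ⊕ (Fin n × Fin L) → ((Fin n × Fin 1) ⊕ (Fin n × Fin 1)) × (Fin 1 × Fin L)
  | Sum.inl p => (Sum.inl (p.1, 0), (0, p.2))
  | Sum.inr p => (Sum.inr (p.1, 0), (0, p.2))

/-- Index map (`𝔖_n(1) ⊗ ⟨1,1,L⟩`)-slot-1/3 → `𝔖_n(L)`-slot-1/3. [folklore] -/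
def ofKronIdx (n L : ℕ) :
    ((Fin n × Fin 1) ⊕ (Fin n × Fin 1)) × (Fin 1 × Fin L) → (Fin n × Fin L) ⊕ (Fin n × Fin L)
  | (Sum.inl p, q) => Sum.inl (p.1, q.2)
  | (Sum.inr p, q) => Sum.inr (p.1, q.2)

/-- **`𝔖_n(1) ⊗ ⟨1,1,L⟩ ≥ 𝔖_n(L)`** (relabelling). [folklore] -/
theorem tensorRestrictsTo_kronecker_twistedStar_one (n L : ℕ) :
    TensorRestrictsTo (kroneckerTensor (twistedStar K n 1) (matMulTensor K 1 1 L))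
      (twistedStar K n L) := by
  -- landed-duplicate guard (lander): the folklore unfolding lemma as a local hypothesis, `rfl`
  have matMulTensor_apply' : ∀ (k m n : ℕ) (a : Fin k × Fin n) (b : Fin k × Fin m) (c : Fin m × Fin n),
      matMulTensor K k m n a b c = if a.1 = b.1 ∧ b.2 = c.1 ∧ a.2 = c.2 then 1 else 0 :=
    fun _ _ _ _ _ _ => rfl
  have e : (fun a b c => kroneckerTensor (twistedStar K n 1) (matMulTensor K 1 1 L)
      (toKronIdx n L a) ((b, ((0 : Fin 1), (0 : Fin 1)))) (toKronIdx n L c)) = twistedStar K n L := by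
    funext a b c
    rcases a with ⟨i, m⟩ | ⟨i, m⟩ <;> rcases c with ⟨j, m'⟩ | ⟨j, m'⟩ <;>
      simp [toKronIdx, matMulTensor_apply', Prod.swap] <;>
      (by_cases h1 : i = b.1 <;> by_cases h2 : b.2 = j <;> by_cases h3 : m = m' <;>
        by_cases h4 : i = b.2 <;> by_cases h5 : b.1 = j <;> simp [h1, h2, h3, h4, h5])
  rw [← e]
  exact tensorRestrictsTo_precomp _ _ _ _

/-- **`𝔖_n(L) ≥ 𝔖_n(1) ⊗ ⟨1,1,L⟩`** (relabelling back). [folklore] -/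
theorem tensorRestrictsTo_twistedStar_kronecker_one (n L : ℕ) :
    TensorRestrictsTo (twistedStar K n L)
      (kroneckerTensor (twistedStar K n 1) (matMulTensor K 1 1 L)) := by
  -- landed-duplicate guard (lander): the folklore unfolding lemma as a local hypothesis, `rfl`
  have matMulTensor_apply' : ∀ (k m n : ℕ) (a : Fin k × Fin n) (b : Fin k × Fin m) (c : Fin m × Fin n),
      matMulTensor K k m n a b c = if a.1 = b.1 ∧ b.2 = c.1 ∧ a.2 = c.2 then 1 else 0 :=
    fun _ _ _ _ _ _ => rfl
  have e : (fun a b c => twistedStar K n L (ofKronIdx n L a) (b.1 : Fin n × Fin n)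
      (ofKronIdx n L c)) = kroneckerTensor (twistedStar K n 1) (matMulTensor K 1 1 L) := by
    funext a b c
    obtain ⟨a₁, ⟨a₂, m⟩⟩ := a
    obtain ⟨c₁, ⟨c₂, m'⟩⟩ := c
    obtain ⟨b₁, ⟨b₂, b₃⟩⟩ := b
    have ha₂ : a₂ = 0 := Subsingleton.elim _ _
    have hc₂ : c₂ = 0 := Subsingleton.elim _ _
    have hb₂ : b₂ = 0 := Subsingleton.elim _ _
    have hb₃ : b₃ = 0 := Subsingleton.elim _ _
    subst ha₂ hc₂ hb₂ hb₃
    rcases a₁ with ⟨i, u⟩ | ⟨i, u⟩ <;> rcases c₁ with ⟨j, u'⟩ | ⟨j, u'⟩ <;>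
      (have hu : u = 0 := Subsingleton.elim _ _) <;> (have hu' : u' = 0 := Subsingleton.elim _ _) <;>
      subst hu hu' <;>
      simp [ofKronIdx, matMulTensor_apply', Prod.swap] <;>
      (by_cases h1 : i = b₁.1 <;> by_cases h2 : b₁.2 = j <;> by_cases h3 : m = m' <;>
        by_cases h4 : i = b₁.2 <;> by_cases h5 : b₁.1 = j <;> simp [h1, h2, h3, h4, h5])
  rw [← e]
  exact tensorRestrictsTo_precomp _ _ _ _

/-- `⟨1,1,L⟩ ≥ ⟨1⟩` for `L ≥ 1`. [folklore] -/
theorem tensorRestrictsTo_matMul_one_one_unit (L : ℕ) (hL : 1 ≤ L) :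
    TensorRestrictsTo (matMulTensor K 1 1 L) (unitTensor K 1) := by
  -- landed-duplicate guard (lander): the folklore unfolding lemma as a local hypothesis, `rfl`
  have matMulTensor_apply' : ∀ (k m n : ℕ) (a : Fin k × Fin n) (b : Fin k × Fin m) (c : Fin m × Fin n),
      matMulTensor K k m n a b c = if a.1 = b.1 ∧ b.2 = c.1 ∧ a.2 = c.2 then 1 else 0 :=
    fun _ _ _ _ _ _ => rfl
  have e : (fun a b c => matMulTensor K 1 1 L ((fun _ => ((0 : Fin 1), (⟨0, hL⟩ : Fin L))) a)
      ((fun _ => ((0 : Fin 1), (0 : Fin 1))) b) ((fun _ => ((0 : Fin 1), (⟨0, hL⟩ : Fin L))) c)) =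
      unitTensor K 1 := by
    funext a b c
    rw [unitTensor_one]
    simp [matMulTensor_apply']
  rw [← e]
  exact tensorRestrictsTo_precomp _ _ _ _

/-- **`F(𝔖_n(L)) = F(𝔖_n(1)) · F⟨1,1,L⟩`** at every universal spectral point, and
`F⟨1,1,L⟩ ≥ 1` for `L ≥ 1`. [cite: ChristandlVranaZuiddam2023, §1.2] -/
theorem spectralPoint_twistedStar_eq_mul {K : Type} [CommSemiring K] {F : SpectralMap K}
    (hF : IsUniversalSpectralPoint K F) (n L : ℕ) :
    F (twistedStar K n L) = F (twistedStar K n 1) * F (matMulTensor K 1 1 L) := by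
  rw [← hF.map_kronecker]
  exact hF.eq_of_restrictsTo (tensorRestrictsTo_kronecker_twistedStar_one n L)
    (tensorRestrictsTo_twistedStar_kronecker_one n L)

/-- `1 ≤ F⟨1,1,L⟩` for `L ≥ 1` at every universal spectral point (monotonicity from `⟨1,1,L⟩ ≥ ⟨1⟩`). [folklore] -/
theorem one_le_spectralPoint_matMul_one_one {K : Type} [CommSemiring K] {F : SpectralMap K}
    (hF : IsUniversalSpectralPoint K F) (L : ℕ) (hL : 1 ≤ L) :
    1 ≤ F (matMulTensor K 1 1 L) := by
  rw [← hF.map_unitTensor_one]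
  exact hF.mono _ _ (tensorRestrictsTo_matMul_one_one_unit L hL)

/-! ### Reduction of transpose cashing to `L = 1` -/

/-- Index maps exhibiting `⟨n,n,L+L⟩ ≡ ⟨n,n,1+1⟩ ⊗ ⟨1,1,L⟩`, on `Fin n × (Fin L ⊕ Fin L)`.
[folklore] -/
def kronCore₂ (n L : ℕ) : Fin n × (Fin L ⊕ Fin L) → (Fin n × Fin (1 + 1)) × (Fin 1 × Fin L)
  | (i, Sum.inl m) => ((i, 0), (0, m))
  | (i, Sum.inr m) => ((i, 1), (0, m))

/-- The same map on `Fin n × Fin (L + L)`. [folklore] -/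
def toKronIdx₂ (n L : ℕ) (p : Fin n × Fin (L + L)) : (Fin n × Fin (1 + 1)) × (Fin 1 × Fin L) :=
  kronCore₂ n L (p.1, finSumFinEquiv.symm p.2)

/-- `toKronIdx₂` evaluated on an inner index presented through `finSumFinEquiv`. [folklore] -/
theorem toKronIdx₂_apply (n L : ℕ) (i : Fin n) (x : Fin L ⊕ Fin L) :
    toKronIdx₂ n L (i, finSumFinEquiv x) = kronCore₂ n L (i, x) := by
  simp only [toKronIdx₂, Equiv.symm_apply_apply]

/-- `⟨n,n,1+1⟩ ⊗ ⟨1,1,L⟩ ≥ ⟨n,n,L+L⟩` (relabelling). [folklore] -/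
theorem tensorRestrictsTo_kronecker_matMul_two (n L : ℕ) :
    TensorRestrictsTo (kroneckerTensor (matMulTensor K n n (1 + 1)) (matMulTensor K 1 1 L))
      (matMulTensor K n n (L + L)) := by
  -- landed-duplicate guard (lander): the folklore unfolding lemma as a local hypothesis, `rfl`
  have matMulTensor_apply' : ∀ (k m n : ℕ) (a : Fin k × Fin n) (b : Fin k × Fin m) (c : Fin m × Fin n),
      matMulTensor K k m n a b c = if a.1 = b.1 ∧ b.2 = c.1 ∧ a.2 = c.2 then 1 else 0 :=
    fun _ _ _ _ _ _ => rfl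
  have e : (fun a b c => kroneckerTensor (matMulTensor K n n (1 + 1)) (matMulTensor K 1 1 L)
      (toKronIdx₂ n L a) ((b, ((0 : Fin 1), (0 : Fin 1)))) (toKronIdx₂ n L c)) =
      matMulTensor K n n (L + L) := by
    funext a b c
    obtain ⟨i, ν⟩ := a
    obtain ⟨j, ν'⟩ := c
    obtain ⟨x, rfl⟩ := finSumFinEquiv.surjective ν
    obtain ⟨x', rfl⟩ := finSumFinEquiv.surjective ν'
    simp only [toKronIdx₂_apply, kroneckerTensor_apply, matMulTensor_apply',
      EmbeddingLike.apply_eq_iff_eq]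
    rcases x with m | m <;> rcases x' with m' | m' <;>
      simp [kronCore₂] <;>
      (by_cases h1 : i = b.1 <;> by_cases h2 : b.2 = j <;> by_cases h3 : m = m' <;>
        simp [h1, h2, h3])
  rw [← e]
  exact tensorRestrictsTo_precomp _ _ _ _

/-- Index map back: (`⟨n,n,1+1⟩ ⊗ ⟨1,1,L⟩`)-slot → `⟨n,n,L+L⟩`-slot. [folklore] -/
def ofKronIdx₂ (n L : ℕ) (p : (Fin n × Fin (1 + 1)) × (Fin 1 × Fin L)) : Fin n × Fin (L + L) :=
  (p.1.1, finSumFinEquiv (if p.1.2 = 0 then Sum.inl p.2.2 else Sum.inr p.2.2))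

/-- `⟨n,n,L+L⟩ ≥ ⟨n,n,1+1⟩ ⊗ ⟨1,1,L⟩` (relabelling back). [folklore] -/
theorem tensorRestrictsTo_matMul_two_kronecker (n L : ℕ) :
    TensorRestrictsTo (matMulTensor K n n (L + L))
      (kroneckerTensor (matMulTensor K n n (1 + 1)) (matMulTensor K 1 1 L)) := by
  -- landed-duplicate guard (lander): the folklore unfolding lemma as a local hypothesis, `rfl`
  have matMulTensor_apply' : ∀ (k m n : ℕ) (a : Fin k × Fin n) (b : Fin k × Fin m) (c : Fin m × Fin n),
      matMulTensor K k m n a b c = if a.1 = b.1 ∧ b.2 = c.1 ∧ a.2 = c.2 then 1 else 0 :=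
    fun _ _ _ _ _ _ => rfl
  have e : (fun a b c => matMulTensor K n n (L + L) (ofKronIdx₂ n L a) (b.1 : Fin n × Fin n)
      (ofKronIdx₂ n L c)) =
      kroneckerTensor (matMulTensor K n n (1 + 1)) (matMulTensor K 1 1 L) := by
    funext a b c
    obtain ⟨⟨i, s⟩, ⟨a₂, m⟩⟩ := a
    obtain ⟨⟨j, s'⟩, ⟨c₂, m'⟩⟩ := c
    obtain ⟨b₁, ⟨b₂, b₃⟩⟩ := b
    have ha₂ : a₂ = 0 := Subsingleton.elim _ _
    have hc₂ : c₂ = 0 := Subsingleton.elim _ _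
    have hb₂ : b₂ = 0 := Subsingleton.elim _ _
    have hb₃ : b₃ = 0 := Subsingleton.elim _ _
    subst ha₂ hc₂ hb₂ hb₃
    simp only [ofKronIdx₂, kroneckerTensor_apply, matMulTensor_apply', EmbeddingLike.apply_eq_iff_eq,
      true_and]
    rcases Fin.exists_fin_two.mp ⟨s, rfl⟩ with hs | hs <;>
      rcases Fin.exists_fin_two.mp ⟨s', rfl⟩ with hs' | hs' <;> subst hs <;> subst hs' <;>
      (by_cases h1 : i = b₁.1 <;> by_cases h2 : b₁.2 = j <;> by_cases h3 : m = m' <;>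
        simp [h1, h2, h3])
  rw [← e]
  exact tensorRestrictsTo_precomp _ _ _ _

/-- **`F⟨n,n,L+L⟩ = F⟨n,n,1+1⟩ · F⟨1,1,L⟩`** at every universal spectral point.
[cite: ChristandlVranaZuiddam2023, §1.2] -/
theorem spectralPoint_matMul_double_eq_mul {K : Type} [CommSemiring K] {F : SpectralMap K}
    (hF : IsUniversalSpectralPoint K F) (n L : ℕ) :
    F (matMulTensor K n n (L + L)) = F (matMulTensor K n n (1 + 1)) * F (matMulTensor K 1 1 L) := by
  rw [← hF.map_kronecker]
  exact hF.eq_of_restrictsTo (tensorRestrictsTo_kronecker_matMul_two n L)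
    (tensorRestrictsTo_matMul_two_kronecker n L)

/-- **Reduction to `L = 1`, pointwise on the spectrum.**  Transpose cashing `AC_n(L)` — the
question «Q-𝔖» of the cell in its two-format case; lens 1's `AC_q` at `L = 1` — typed spectrally
reads `F⟨n,n,L+L⟩ ≤ F(𝔖_n(L))` for every universal spectral point `F` (by Strassen's spectral
theorem: `𝔖_n(L) ≳ ⟨n,n,2L⟩`; NOT asserted anywhere in this file).  At each `F` the inequality for
`L ≥ 1` is equivalent to the one for `L = 1`: both sides carry the common factor `F⟨1,1,L⟩ ≥ 1`,
which cancels — no appeal to Strassen's theorem is needed in the spectral typing. [folklore] -/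
theorem spectralPoint_transposeCashing_iff_one {K : Type} [CommSemiring K] {F : SpectralMap K}
    (hF : IsUniversalSpectralPoint K F) (n L : ℕ) (hL : 1 ≤ L) :
    F (matMulTensor K n n (L + L)) ≤ F (twistedStar K n L) ↔
      F (matMulTensor K n n (1 + 1)) ≤ F (twistedStar K n 1) := by
  have hpos : 0 < F (matMulTensor K 1 1 L) :=
    lt_of_lt_of_le zero_lt_one (one_le_spectralPoint_matMul_one_one hF L hL)
  rw [spectralPoint_matMul_double_eq_mul hF n L, spectralPoint_twistedStar_eq_mul hF n L]
  constructor
  · intro h1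
    exact le_of_mul_le_mul_right h1 hpos
  · intro h1
    exact mul_le_mul_of_nonneg_right h1 (hF.nonneg _)

/-- **`AC_n(L) ↔ AC_n(1)` (`L ≥ 1`)**, the transpose-cashing statement quantified over the whole
asymptotic spectrum. [folklore] -/
theorem transposeCashing_iff_one {K : Type} [CommSemiring K] (n L : ℕ) (hL : 1 ≤ L) :
    (∀ F : SpectralMap K, IsUniversalSpectralPoint K F →
        F (matMulTensor K n n (L + L)) ≤ F (twistedStar K n L)) ↔
      (∀ F : SpectralMap K, IsUniversalSpectralPoint K F →
        F (matMulTensor K n n (1 + 1)) ≤ F (twistedStar K n 1)) :=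
  ⟨fun h F hF => (spectralPoint_transposeCashing_iff_one hF n L hL).1 (h F hF),
    fun h F hF => (spectralPoint_transposeCashing_iff_one hF n L hL).2 (h F hF)⟩

/-- **Transpose cashing holds up to the factor `2`** at every universal spectral point
(`⟨n,n,2L⟩ ≤ 𝔖_n(L) ⊕ 𝔖_n(L)`). [folklore] -/
theorem transposeCashing_upToTwo {K : Type} [CommSemiring K] (n L : ℕ) (F : SpectralMap K)
    (hF : IsUniversalSpectralPoint K F) :
    F (matMulTensor K n n (L + L)) ≤ 2 * F (twistedStar K n L) :=
  (spectralPoint_twistedStar_sandwich hF n L).2.2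

end TwistedStar

end Summit.MatrixMultiplication.MatrixMultiplication.Theorems.FarEdgeDescentTwistedStar

end
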